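import Summits.CriticalPhenomena.PercolationContinuityZ3.Theorems.Transplant.BoxProdZ2SeedGeom
import Summits.CriticalPhenomena.PercolationContinuityZ3.Theorems.Transplant.BoxProdZ2TubeLevels
import Summits.CriticalPhenomena.PercolationContinuityZ3.Theorems.Transplant.KNLevelsStepIII
import Summits.CriticalPhenomena.PercolationContinuityZ3.Theorems.Transplant.KNLevelsPacking
import HarnessLib

/-!
# F6-prod, the seed kit of `X □ ℤ²` (definitions): planar window data of a macro contact, THICK seeds (slice plaquette + fibre set +
# thick rungs), thick faces and cubes, the separation neighbourhoods, and the `KNLevels.SData` of a tube level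
# (BLUEPRINT-I-PHI §1 rows "Step III seeds" / "cube behind a contact", §6 Target 1; instance of p2's `KNLevels.SData`, `Transplant/KNLevelsStepIII.lean`)

builds on p205010 (kernel theorem, internal audit signed; external expert review pending) — nothing in this file uses p205010.
Lane `prim-bschramm`, seat `prim-bschramm-p3` (task F6 (b), split agreed with p2-g2 07:45Z/07:55Z); helper file
(`--supports stmt-CriticalPhenomena-4575 --as helper`).

Setting (STATUS 07:55Z): Lemma 10 for `X □ ℤ²` runs in the tube graph `tubeGraph X π` over the window `π = B_X(xe, Rw)` with the planar
levels `tubeLevel π lo hi j = π × Icc Lo Hi`, `Lo = lo - j`, `Hi = hi + j`; contacts are MACRO: `x = (w, y + σ e_i)` with `w ∈ π` and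
Kozma–Nitzan's planar window data `WinHyp Lo Hi M i σ y` in the slice `{w} × ℤ²` (p2's `exists_winHyp_of_macroContact`).  The cube behind
`x` is the fibre-fat prism `B_X(c, nF) × (v(P) + Λ_M)` with `c = fibCtr` (the retraction of `w` towards `xe`, `BoxProdZ2SeedGeom`), its face
`U = B_X(c, nF) × U(P)`, and the THICK SEED of `x` consists of (a) KN's planar seed edges in the slice `{w} × ℤ²`, (b) at every plaquette
height `z ∈ P` all `X`-edges inside the fibre set `fibSet ∋ w, ⊇ B_X(c, nF)`, (c) the thick rungs `(b, z) — (b, z - σ e_i)`, `b ∈ B_X(c, nF)`,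
`z ∈ P`.  All seed vertices have planar depth `≤ 0` in `B⟨j⟩`, so the seed avoids the pairs inside the shell `π × Icc (Lo+1) (Hi-1)`.
Contents: §1 `pwin` (chosen planar window data) and its specification; §2 the totalised fibre data `fibSetT` / `fibCtrT`; §3 `kitSeed`,
`kitFace`, `kitCube`, `kitNear` (separation neighbourhood `B_X(w, 2(2nF+1)) × (t + Λ_{2(2M+4)})`), the constants `kitB`, `kitSB`, and
`kitSData` (with `pick = apartSel kitNear`); §4 the case analysis `mem_kitSeed_cases` and the neighbourhood lemmas.  The axioms `SHyp`
and the shell/avoidance/cube lemmas are the companion file `BoxProdZ2SeedKit`.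

[cite: KozmaNitzan2024, §4 Lemma 10, p. 19 (seeds, plaquettes), p. 21 (v(P), U(P)) — the ℤ^d model] [cite: GrimmettPercolation1999, §7.2]
-/

noncomputable section

namespace Summit.CriticalPhenomena.PercolationContinuityZ3.Theorems

namespace Transplant

namespace BoxProdZ2

open Literature.Probability.Percolation Literature.Probability.LatticeModels SimpleGraph
open Literature.Probability.Percolation.KozmaNitzan
open Literature.Barriers.CriticalPhenomena (graphBall graphBall_finite mem_graphBall_self graphBall_mono)
open KNLevels

variable {W : Type*} [DecidableEq W] (X : SimpleGraph W) [X.LocallyFinite]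

/-! ## §1 The planar window data of a planar contact -/

/-- The chosen planar window data `(i, σ, y)` of a planar point `t` outside the box `Icc Lo Hi`: `t = y + σ e_i` with Kozma–Nitzan's
`WinHyp Lo Hi M i σ y` (a choice; `KozmaNitzan.exists_winHyp_of_mem_outerBoundary` at `d = 2`). [cite: KozmaNitzan2024, §4 pp. 19–21] -/
def pwin (Lo Hi : Site 2) (M : ℕ) (t : Site 2) : Fin 2 × ℤ × Site 2 :=
  Classical.epsilon fun q : Fin 2 × ℤ × Site 2 => WinHyp Lo Hi M q.1 q.2.1 q.2.2 ∧ t = q.2.2 + q.2.1 • unitVec q.1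

/-- Specification of the planar window data of an outer-boundary point of a wide box. [cite: KozmaNitzan2024, §4 pp. 19–21] -/
theorem pwin_spec {Lo Hi : Site 2} {M : ℕ} (hwide : ∀ k, Lo k + 2 * M + 2 ≤ Hi k) {t : Site 2}
    (ht : t ∈ outerBoundary (zdGraph 2) (Finset.Icc Lo Hi)) :
    WinHyp Lo Hi M (pwin Lo Hi M t).1 (pwin Lo Hi M t).2.1 (pwin Lo Hi M t).2.2 ∧
      t = (pwin Lo Hi M t).2.2 + (pwin Lo Hi M t).2.1 • unitVec (pwin Lo Hi M t).1 := by
  obtain ⟨i, σ, y, h, hty⟩ := exists_winHyp_of_mem_outerBoundary hwide ht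
  exact Classical.epsilon_spec (p := fun q : Fin 2 × ℤ × Site 2 =>
    WinHyp Lo Hi M q.1 q.2.1 q.2.2 ∧ t = q.2.2 + q.2.1 • unitVec q.1) ⟨(i, σ, y), h, hty⟩

/-! ## §2 Totalised fibre data of a fibre coordinate -/

open Classical in
/-- The fibre set of `w` relative to the window `B_X(xe, Rw)` (the singleton `{w}` off the window). [folklore] -/
def fibSetT (xe : W) (Rw nF : ℕ) (w : W) : Finset W :=
  if h : w ∈ graphBall X xe Rw then fibSet X h nF else {w}

omit [DecidableEq W] [X.LocallyFinite] in
open Classical in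
/-- The retracted fibre centre of `w` relative to the window `B_X(xe, Rw)` (`w` itself off the window). [folklore] -/
def fibCtrT (xe : W) (Rw nF : ℕ) (w : W) : W :=
  if h : w ∈ graphBall X xe Rw then fibCtr X h nF else w

/-- `fibSetT` on the window. [folklore] -/
theorem fibSetT_eq {xe : W} {Rw : ℕ} (nF : ℕ) {w : W} (hw : w ∈ graphBall X xe Rw) :
    fibSetT X xe Rw nF w = fibSet X hw nF := by
  rw [fibSetT, dif_pos hw]

omit [DecidableEq W] [X.LocallyFinite] in
/-- `fibCtrT` on the window. [folklore] -/
theorem fibCtrT_eq {xe : W} {Rw : ℕ} (nF : ℕ) {w : W} (hw : w ∈ graphBall X xe Rw) :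
    fibCtrT X xe Rw nF w = fibCtr X hw nF := by
  rw [fibCtrT, dif_pos hw]

/-! ## §3 Thick seeds, faces, cubes, neighbourhoods; the seed data of a tube level -/

/-- **The thick seed** of a (macro contact) vertex `x = (w, t)`: KN's planar seed edges of `t` in the slice `{w} × ℤ²`, all `X`-edges
inside the fibre set of `w` at every plaquette height, and the thick rungs from `B_X(c, nF) ×` plaquette into the face.
[cite: KozmaNitzan2024, §4 p. 19 ("Call a given plaquette a seed if …")] -/
def kitSeed (xe : W) (Rw : ℕ) (Lo Hi : Site 2) (M nF : ℕ) (x : W × Site 2) : Finset (Sym2 (W × Site 2)) :=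
  (seedEdges Lo Hi M (pwin Lo Hi M x.2).1 (pwin Lo Hi M x.2).2.1 (pwin Lo Hi M x.2).2.2).image
      (Sym2.map fun t : Site 2 => (x.1, t)) ∪
    (plaq Lo Hi M (pwin Lo Hi M x.2).1 (pwin Lo Hi M x.2).2.2).biUnion (fun z =>
      (edgesIn X (fibSetT X xe Rw nF x.1)).image (Sym2.map fun b : W => (b, z))) ∪
    (ballFin X (fibCtrT X xe Rw nF x.1) nF ×ˢ plaq Lo Hi M (pwin Lo Hi M x.2).1 (pwin Lo Hi M x.2).2.2).image
      (fun bz => s((bz.1, bz.2), (bz.1, bz.2 - (pwin Lo Hi M x.2).2.1 • unitVec (pwin Lo Hi M x.2).1)))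

/-- **The thick face** behind `x`: `B_X(c, nF) × U(P)`. [cite: KozmaNitzan2024, §4 p. 21 (U(P))] -/
def kitFace (xe : W) (Rw : ℕ) (Lo Hi : Site 2) (M nF : ℕ) (x : W × Site 2) : Finset (W × Site 2) :=
  ballFin X (fibCtrT X xe Rw nF x.1) nF ×ˢ uface Lo Hi M (pwin Lo Hi M x.2).1 (pwin Lo Hi M x.2).2.1 (pwin Lo Hi M x.2).2.2

/-- **The thick cube** behind `x`: `B_X(c, nF) × (v(P) + Λ_M)`. [cite: KozmaNitzan2024, §4 p. 19 ("v + [-M,M]^d ⊆ S")] -/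
def kitCube (xe : W) (Rw : ℕ) (Lo Hi : Site 2) (M nF : ℕ) (x : W × Site 2) : Finset (W × Site 2) :=
  ballFin X (fibCtrT X xe Rw nF x.1) nF ×ˢ cube Lo Hi M (pwin Lo Hi M x.2).1 (pwin Lo Hi M x.2).2.1 (pwin Lo Hi M x.2).2.2

/-- **The separation neighbourhood** of `x = (w, t)`: `B_X(w, 2(2nF+1)) × (t + Λ_{2(2M+4)})` — two vertices outside each other's
neighbourhood have disjoint thick seeds. [cite: KozmaNitzan2024, §4 p. 19 (plaquettes at distance > 2(2M+4))] -/
def kitNear (M nF : ℕ) (x : W × Site 2) : Finset (W × Site 2) :=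
  ballFin X x.1 (2 * (2 * nF + 1)) ×ˢ (box 2 (2 * (2 * M + 4))).image fun s => s + x.2

omit [DecidableEq W] [X.LocallyFinite] in
variable {X} in
/-- The size bound of the separation neighbourhoods under a degree bound `Δ`. [folklore] -/
def kitB (Δ M nF : ℕ) : ℕ := (Δ + 1) ^ (2 * (2 * nF + 1)) * (2 * (2 * (2 * M + 4)) + 1) ^ 2

omit [DecidableEq W] [X.LocallyFinite] in
variable {X} in
/-- The size bound of the thick seeds under a degree bound `Δ`. [folklore] -/
def kitSB (Δ M nF : ℕ) : ℕ :=
  seedBound 2 M + (2 * M + 3) ^ 2 * (Δ * (nF + 2 + (Δ + 1) ^ nF)) + (Δ + 1) ^ nF * (2 * M + 3) ^ 2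

/-! ## §4 Basic properties -/

variable {X}

/-- **Case analysis of a thick seed edge**: a slice seed edge, a fibre edge at a plaquette height, or a thick rung. [folklore] -/
theorem mem_kitSeed_cases {xe : W} {Rw : ℕ} {Lo Hi : Site 2} {M nF : ℕ} {x : W × Site 2} {e : Sym2 (W × Site 2)}
    (he : e ∈ kitSeed X xe Rw Lo Hi M nF x) :
    (∃ e₀ ∈ seedEdges Lo Hi M (pwin Lo Hi M x.2).1 (pwin Lo Hi M x.2).2.1 (pwin Lo Hi M x.2).2.2,
        e = Sym2.map (fun t : Site 2 => (x.1, t)) e₀) ∨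
      (∃ z ∈ plaq Lo Hi M (pwin Lo Hi M x.2).1 (pwin Lo Hi M x.2).2.2, ∃ e₀ ∈ edgesIn X (fibSetT X xe Rw nF x.1),
        e = Sym2.map (fun b : W => (b, z)) e₀) ∨
      (∃ b ∈ ballFin X (fibCtrT X xe Rw nF x.1) nF, ∃ z ∈ plaq Lo Hi M (pwin Lo Hi M x.2).1 (pwin Lo Hi M x.2).2.2,
        e = s((b, z), (b, z - (pwin Lo Hi M x.2).2.1 • unitVec (pwin Lo Hi M x.2).1))) := by
  unfold kitSeed at he
  rcases Finset.mem_union.1 he with he | he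
  · rcases Finset.mem_union.1 he with he | he
    · obtain ⟨e₀, he₀, rfl⟩ := Finset.mem_image.1 he
      exact Or.inl ⟨e₀, he₀, rfl⟩
    · obtain ⟨z, hz, he⟩ := Finset.mem_biUnion.1 he
      obtain ⟨e₀, he₀, rfl⟩ := Finset.mem_image.1 he
      exact Or.inr (Or.inl ⟨z, hz, e₀, he₀, rfl⟩)
  · obtain ⟨bz, hbz, rfl⟩ := Finset.mem_image.1 he
    rw [Finset.mem_product] at hbz
    exact Or.inr (Or.inr ⟨bz.1, hbz.1, bz.2, hbz.2, rfl⟩)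

/-- The slice seed edges belong to the thick seed. [folklore] -/
theorem sliceSeed_subset_kitSeed {xe : W} {Rw : ℕ} {Lo Hi : Site 2} {M nF : ℕ} {x : W × Site 2} :
    (seedEdges Lo Hi M (pwin Lo Hi M x.2).1 (pwin Lo Hi M x.2).2.1 (pwin Lo Hi M x.2).2.2).image
        (Sym2.map fun t : Site 2 => (x.1, t)) ⊆ kitSeed X xe Rw Lo Hi M nF x :=
  fun _ he => Finset.mem_union_left _ (Finset.mem_union_left _ he)

/-- The fibre edges at a plaquette height belong to the thick seed. [folklore] -/
theorem fibreSeed_mem_kitSeed {xe : W} {Rw : ℕ} {Lo Hi : Site 2} {M nF : ℕ} {x : W × Site 2} {z : Site 2}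
    (hz : z ∈ plaq Lo Hi M (pwin Lo Hi M x.2).1 (pwin Lo Hi M x.2).2.2) {e₀ : Sym2 W} (he₀ : e₀ ∈ edgesIn X (fibSetT X xe Rw nF x.1)) :
    Sym2.map (fun b : W => (b, z)) e₀ ∈ kitSeed X xe Rw Lo Hi M nF x :=
  Finset.mem_union_left _ (Finset.mem_union_right _ (Finset.mem_biUnion.2 ⟨z, hz, Finset.mem_image.2 ⟨e₀, he₀, rfl⟩⟩))

/-- The thick rungs belong to the thick seed. [folklore] -/
theorem rung_mem_kitSeed {xe : W} {Rw : ℕ} {Lo Hi : Site 2} {M nF : ℕ} {x : W × Site 2} {b : W}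
    (hb : b ∈ ballFin X (fibCtrT X xe Rw nF x.1) nF) {z : Site 2} (hz : z ∈ plaq Lo Hi M (pwin Lo Hi M x.2).1 (pwin Lo Hi M x.2).2.2) :
    s((b, z), (b, z - (pwin Lo Hi M x.2).2.1 • unitVec (pwin Lo Hi M x.2).1)) ∈ kitSeed X xe Rw Lo Hi M nF x :=
  Finset.mem_union_right _ (Finset.mem_image.2 ⟨(b, z), Finset.mem_product.2 ⟨hb, hz⟩, rfl⟩)

omit [DecidableEq W] in
/-- Membership in the thick face. [folklore] -/
theorem mem_kitFace_iff {xe : W} {Rw : ℕ} {Lo Hi : Site 2} {M nF : ℕ} {x u : W × Site 2} :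
    u ∈ kitFace X xe Rw Lo Hi M nF x ↔ u.1 ∈ ballFin X (fibCtrT X xe Rw nF x.1) nF ∧
      u.2 ∈ uface Lo Hi M (pwin Lo Hi M x.2).1 (pwin Lo Hi M x.2).2.1 (pwin Lo Hi M x.2).2.2 := by
  rw [kitFace, Finset.mem_product]

omit [DecidableEq W] in
/-- Membership in the thick cube. [folklore] -/
theorem mem_kitCube_iff {xe : W} {Rw : ℕ} {Lo Hi : Site 2} {M nF : ℕ} {x u : W × Site 2} :
    u ∈ kitCube X xe Rw Lo Hi M nF x ↔ u.1 ∈ ballFin X (fibCtrT X xe Rw nF x.1) nF ∧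
      u.2 ∈ cube Lo Hi M (pwin Lo Hi M x.2).1 (pwin Lo Hi M x.2).2.1 (pwin Lo Hi M x.2).2.2 := by
  rw [kitCube, Finset.mem_product]

omit [DecidableEq W] in
/-- Membership in the separation neighbourhood. [folklore] -/
theorem mem_kitNear_iff {M nF : ℕ} {x y : W × Site 2} :
    y ∈ kitNear X M nF x ↔ y.1 ∈ ballFin X x.1 (2 * (2 * nF + 1)) ∧ y.2 - x.2 ∈ box 2 (2 * (2 * M + 4)) := by
  rw [kitNear, Finset.mem_product, Finset.mem_image]
  refine and_congr_right fun _ => ⟨?_, fun h => ⟨y.2 - x.2, h, sub_add_cancel _ _⟩⟩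
  rintro ⟨s, hs, hsy⟩
  rw [← hsy, add_sub_cancel_right]; exact hs

omit [DecidableEq W] in
/-- Every vertex lies in its own separation neighbourhood. [folklore] -/
theorem mem_kitNear_self (M nF : ℕ) (x : W × Site 2) : x ∈ kitNear X M nF x := by
  rw [mem_kitNear_iff, sub_self]
  exact ⟨center_mem_ballFin X x.1 _, zero_mem_box 2 _⟩

omit [DecidableEq W] in
/-- The separation neighbourhoods are symmetric. [folklore] -/
theorem kitNear_symm (M nF : ℕ) (x y : W × Site 2) (h : y ∈ kitNear X M nF x) : x ∈ kitNear X M nF y := by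
  rw [mem_kitNear_iff] at h ⊢
  refine ⟨(mem_ballFin X).2 ((mem_graphBall_comm X).1 ((mem_ballFin X).1 h.1)), ?_⟩
  have h2 := h.2
  rw [mem_box] at h2 ⊢
  intro i
  have := h2 i
  simp only [Pi.sub_apply] at this ⊢
  omega

/-- The separation neighbourhoods have at most `kitB Δ M nF` vertices. [folklore] -/
theorem card_kitNear_le {Δ : ℕ} (hΔ : ∀ w, X.degree w ≤ Δ) (M nF : ℕ) (x : W × Site 2) :
    (kitNear X M nF x).card ≤ kitB Δ M nF := by
  rw [kitNear, Finset.card_product, kitB]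
  refine Nat.mul_le_mul (card_ballFin_le X hΔ x.1 _) (Finset.card_image_le.trans ?_)
  rw [card_box]

omit [DecidableEq W] [X.LocallyFinite] in
/-- `kitB` is positive. [folklore] -/
theorem kitB_pos (Δ M nF : ℕ) : 0 < kitB Δ M nF := by
  unfold kitB; positivity

variable (X)

/-- **The seed data of the tube level `j`** over the window `B_X(xe, Rw)`: candidate contacts = the (macro) outer boundary of the level in
the tube graph, thick seeds and faces, the greedy selection of `k` contacts pairwise outside each other's separation neighbourhoods among
`N = k · kitB`, and the seed size bound `kitSB`. [cite: KozmaNitzan2024, §4 p. 19 (Step III)] -/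
def kitSData {Δ : ℕ} (hΔ : ∀ w, X.degree w ≤ Δ) (xe : W) (Rw : ℕ) (lo hi : Site 2) (j M nF k : ℕ) : SData (W × Site 2) where
  K := outerBoundary (tubeGraph X (ballFin X xe Rw)) (tubeLevel (ballFin X xe Rw) lo hi j)
  seed := kitSeed X xe Rw (lo - (j : Site 2)) (hi + (j : Site 2)) M nF
  face := kitFace X xe Rw (lo - (j : Site 2)) (hi + (j : Site 2)) M nF
  pick := apartSel (kitNear X M nF) (mem_kitNear_self M nF) (kitNear_symm M nF) (kitB_pos Δ M nF) (card_kitNear_le hΔ M nF) k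
  N := k * kitB Δ M nF
  k := k
  sB := kitSB Δ M nF

/-- The candidate contacts of `kitSData`. [folklore] -/
@[simp] theorem kitSData_K {Δ : ℕ} (hΔ : ∀ w, X.degree w ≤ Δ) (xe : W) (Rw : ℕ) (lo hi : Site 2) (j M nF k : ℕ) :
    (kitSData X hΔ xe Rw lo hi j M nF k).K = outerBoundary (tubeGraph X (ballFin X xe Rw)) (tubeLevel (ballFin X xe Rw) lo hi j) := rfl

/-- The seeds of `kitSData`. [folklore] -/
@[simp] theorem kitSData_seed {Δ : ℕ} (hΔ : ∀ w, X.degree w ≤ Δ) (xe : W) (Rw : ℕ) (lo hi : Site 2) (j M nF k : ℕ) :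
    (kitSData X hΔ xe Rw lo hi j M nF k).seed = kitSeed X xe Rw (lo - (j : Site 2)) (hi + (j : Site 2)) M nF := rfl

/-- The faces of `kitSData`. [folklore] -/
@[simp] theorem kitSData_face {Δ : ℕ} (hΔ : ∀ w, X.degree w ≤ Δ) (xe : W) (Rw : ℕ) (lo hi : Site 2) (j M nF k : ℕ) :
    (kitSData X hΔ xe Rw lo hi j M nF k).face = kitFace X xe Rw (lo - (j : Site 2)) (hi + (j : Site 2)) M nF := rfl

/-- The constants of `kitSData`. [folklore] -/
theorem kitSData_consts {Δ : ℕ} (hΔ : ∀ w, X.degree w ≤ Δ) (xe : W) (Rw : ℕ) (lo hi : Site 2) (j M nF k : ℕ) :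
    (kitSData X hΔ xe Rw lo hi j M nF k).N = k * kitB Δ M nF ∧ (kitSData X hΔ xe Rw lo hi j M nF k).k = k ∧
      (kitSData X hΔ xe Rw lo hi j M nF k).sB = kitSB Δ M nF := ⟨rfl, rfl, rfl⟩

/-- The selection of `kitSData` is a subset. [folklore] -/
theorem kitSData_pick_subset {Δ : ℕ} (hΔ : ∀ w, X.degree w ≤ Δ) (xe : W) (Rw : ℕ) (lo hi : Site 2) (j M nF k : ℕ)
    (κ : Finset (W × Site 2)) : (kitSData X hΔ xe Rw lo hi j M nF k).pick κ ⊆ κ :=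
  apartSel_subset (kitNear X M nF) (mem_kitNear_self M nF) (kitNear_symm M nF) (kitB_pos Δ M nF) (card_kitNear_le hΔ M nF) k κ

/-- The selection of `kitSData` on large sets: `k` elements, pairwise outside each other's separation neighbourhoods. [folklore] -/
theorem kitSData_pick_spec {Δ : ℕ} (hΔ : ∀ w, X.degree w ≤ Δ) (xe : W) (Rw : ℕ) (lo hi : Site 2) (j M nF k : ℕ)
    {κ : Finset (W × Site 2)} (hκ : k * kitB Δ M nF ≤ κ.card) :
    ((kitSData X hΔ xe Rw lo hi j M nF k).pick κ).card = k ∧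
      ∀ x ∈ (kitSData X hΔ xe Rw lo hi j M nF k).pick κ, ∀ y ∈ (kitSData X hΔ xe Rw lo hi j M nF k).pick κ,
        x ≠ y → y ∉ kitNear X M nF x :=
  have h := apartSel_spec (kitNear X M nF) (mem_kitNear_self M nF) (kitNear_symm M nF) (kitB_pos Δ M nF)
    (card_kitNear_le hΔ M nF) hκ
  ⟨h.2.1, h.2.2⟩

end BoxProdZ2

end Transplant

end Summit.CriticalPhenomena.PercolationContinuityZ3.Theorems

end
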